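import Summits.Parity.GeneralizedHardyLittlewood.Theorems.PrimeLevelFamEdgeMomentsBeyondDiagonalDiagBoseZero
import HarnessLib

/-!
# Route `PrimeLevelFamEdge`, crux K_A `MomentsBeyondDiagonal` (stmt-Parity-20007), line «petersson_layers» v4, stub `stub_diag`:
# the Bose coefficients `c_{a0}(y)` are ONE-dimensional integrals `∫_0^∞ (log u)^a du/(e^{u+y/u} − 1)` (census R2)

The universal coefficients of the diagonal line series (`…DiagBoseOuter.bose_expand`) are
`c_{ab}(y) = ∫_{u₁>0}(log u₁)^a ∫_{u₂>y/u₁} e^{−φ}(1−e^{−φ})^{−2}(log u₂)^b` (`φ = u₁+u₂`). For `b = 0` the inner integral is elementary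
(`…DiagBoseZero.integral_Ioi_bose_eq`: `= 1/(e^{u₁+y/u₁} − 1)`), so

* `bose_coeff_b_zero_eq` — `c_{a0}(y) = ∫_0^∞ (log u)^a /(e^{u+y/u} − 1) du` (`y > 0`),

the log-weighted analogue of K_B's `Corner.scriptW y = ∫_0^∞ du/(e^{u+y/u} − 1)` (`a = 0`). These are the coefficients met at
orders `(i, 0)`; their small-`y` expansion is the `a`-fold log-moment version of `CornerWeightE` (R2). Helper `--supports
stmt-Parity-20007`; closes nothing; K_A, K_B and the Parity summit are NOT proved; nothing about Landau–Siegel zeros.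
-/

noncomputable section

open Real Set MeasureTheory

namespace Summit.Parity.GeneralizedHardyLittlewood.Theorems.MomentsBeyondDiagonal.DiagLines

/-- **`c_{a0}` is a one-dimensional integral**: for `y > 0` and every `a`,
`∫_{u₁>0}(log u₁)^a ∫_{u₂>y/u₁} e^{−(u₁+u₂)}(1−e^{−(u₁+u₂)})^{−2}(log u₂)^0 du₂ du₁ = ∫_{u>0} (log u)^a (e^{u+y/u} − 1)⁻¹ du`.
[cite: KowalskiMichelVanderKam2000, (21)–(23) p. 12–13 — derivation] -/
theorem bose_coeff_b_zero_eq {y : ℝ} (hy : 0 < y) (a : ℕ) :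
    ∫ u₁ in Ioi (0 : ℝ), Real.log u₁ ^ a *
        ∫ u₂ in Ioi (y / u₁), Real.exp (-(u₁ + u₂)) / (1 - Real.exp (-(u₁ + u₂))) ^ 2 * Real.log u₂ ^ 0 =
      ∫ u in Ioi (0 : ℝ), Real.log u ^ a * (Real.exp (u + y / u) - 1)⁻¹ := by
  refine setIntegral_congr_fun measurableSet_Ioi fun u₁ hu₁ ↦ ?_
  have hu₁ : 0 < u₁ := hu₁
  simp only [pow_zero, mul_one]
  rw [integral_Ioi_bose_eq u₁ (by positivity)]

/-- The same with the other log shift absent as a `0`-th power on the outer variable: `c_{0b}` by the symmetric formula is NOT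
claimed here; this is the `a`-family only. For `a = 0` it is `Corner.scriptW` (`bose_zero_zero_eq_scriptW`). -/
theorem bose_coeff_zero_zero_eq' (y : ℝ) :
    ∫ u in Ioi (0 : ℝ), Real.log u ^ 0 * (Real.exp (u + y / u) - 1)⁻¹ =
      BeyondDiagonalBeatsQuarter.Corner.scriptW y := by
  unfold BeyondDiagonalBeatsQuarter.Corner.scriptW
  refine setIntegral_congr_fun measurableSet_Ioi fun u _ ↦ ?_
  simp only [pow_zero, one_mul]

end Summit.Parity.GeneralizedHardyLittlewood.Theorems.MomentsBeyondDiagonal.DiagLines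

end
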